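import Literature.Geometry.Lorentzian.KerrSchildChartCovariance
import HarnessLib

/-!
# The Kretschmann scalar of the Kerr metric (closed form) — named fact

Topic `Geometry/Lorentzian`. The Kerr family is Petrov type D with Weyl scalar
`Ψ₂ = −M/(r − i a cos θ)³` (Kinnersley 1969; Chandrasekhar 1983, §58), and being Ricci-flat
(`Kerr.isRicciFlat_holds`, `KerrRicciFlat.lean`) its only non-trivial quadratic curvature invariant
is the Kretschmann scalar, printed in closed form by Visser, *The Kerr spacetime: a brief
introduction*, arXiv:0706.0622, §3 ("the only nontrivial quadratic curvature invariant is"):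

  `R_{abcd} R^{abcd} = C_{abcd} C^{abcd} = 48 m² (r² − a² cos²θ) [(r² + a² cos²θ)² − 16 r² a² cos²θ] / (r² + a² cos²θ)⁶`

(repeated in Boyer–Lindquist coordinates in §5: "the invariant quantity `R_{abcd} R^{abcd}` looks
identical … because the `r` and `θ` coordinates have not been modified"), equivalently
`48 M² Re (r + i a cos θ)⁶ / Σ⁶ = 48 Re Ψ₂²`, `Σ = r² + a² cos²θ`
(expand: `(r² − a²c²)[(r² + a²c²)² − 16r²a²c²] = r⁶ − 15r⁴a²c² + 15r²a⁴c⁴ − a⁶c⁶ = Re (r + iac)⁶`).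
A scalar invariant, it has the same value in every chart; here it is recorded in the INGOING
KERR–SCHILD CARTESIAN chart of the tree (`Kerr.bilin M a`, `KerrSchild.lean`; `cos θ = x₃/r` with
`r = Kerr.radius a x`) through the coordinate tensor calculus `MetricCoord.rmNormSqAt`
(`CoordCurvatureNormSq.lean`: `|Rm|²_G = g^{aa'}g^{cc'}(−tr R(b_a,b_c)R(b_{a'},b_{c'}))`, Topping's
`g g g g R R`), as the named fact `Kerr.kretschmannScalar_closedForm` — VERBATIM the leading
hypothesis `hQ` of `Summit.FinalStateConjecture.…Theorems.PhotonSphereChannels.TameCensorshipCrush.stub_phaseRigidity_main`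
(`PhotonSphereChannelsTameCensorshipPhaseRigidity.lean`), which thereby becomes a consequence of a
catalogued fact, and the Kerr-side input of curvature-based exclusions of "quiet near-Kerr collar
charts" in flat or far-field regions (crux `GenericCensorshipCollarMargin`, stmt-FinalStateConjecture-10809:
a `δ`-`C²`-quiet windowed collar chart forces `|Rm|² ≈ 48M²/r⁶ ≥ 48 m₀⁴/729` at the image of an
equatorial slab point, impossible in Minkowski space).

Nothing is asserted (`def … : Prop`); `kretschmannScalar_equatorial` unpacks the equatorial value
`48 M²/r⁶` (`x₃ = 0`). Discharge route: the sixteen-identity Ricci computation of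
`KerrIngoingCoordRicci*.lean` extended to the Riemann tensor in ingoing Kerr coordinates, then
naturality (`MetricCoord.quadTrace_pullMetric`) back to the Cartesian chart.

## References

* M. Visser, *The Kerr spacetime: a brief introduction*, arXiv:0706.0622 (2007), §3 and §5
  (pp. 6, 10 of the held text read 2026-08-16). [arXiv07060622]
* S. Chandrasekhar, *The mathematical theory of black holes* (1983), §58.
* R. C. Henry, *Kretschmann scalar for a Kerr–Newman black hole*, Astrophys. J. 535 (2000) 350.
-/

noncomputable section

open scoped Manifold ContDiff
open Set

namespace Literature.Geometry.Lorentzian.Kerr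

/-- **The Kretschmann scalar of Kerr in closed form — NAMED FACT, nothing asserted.** For all real
`M, a` and every point `x` of the Kerr–Schild Cartesian chart with `r = Kerr.radius a x > 0`, the
full contraction `|Rm|²` of the curvature of the Kerr–Schild components `Kerr.bilin M a = η + 2Hℓ⊗ℓ`
(`MetricCoord.rmNormSqAt`) is
`48 M² Re (r + i a cos θ)⁶ / (r² + a² cos²θ)⁶`, `cos θ = x₃ / r` — Visser's
`R_{abcd}R^{abcd} = 48 m² (r² − a²cos²θ)[(r² + a²cos²θ)² − 16 r²a²cos²θ]/(r² + a²cos²θ)⁶`, a scalar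
invariant read in the tree's chart. Verbatim the hypothesis `hQ` of `stub_phaseRigidity_main`.
[cite: arXiv07060622, §3] -/
def kretschmannScalar_closedForm : Prop :=
  ∀ (M a : ℝ) (x : E4), 0 < Kerr.radius a x →
    MetricCoord.rmNormSqAt (Kerr.bilin M a) x =
      48 * M ^ 2 * (((Kerr.radius a x : ℂ) +
        ((a * (x 3 / Kerr.radius a x) : ℝ) : ℂ) * Complex.I) ^ 6).re /
        (Kerr.radius a x ^ 2 + (a * (x 3 / Kerr.radius a x)) ^ 2) ^ 6

/-- **Equatorial value.** Under the fact, at a point of the equatorial hyperplane `x₃ = 0` with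
`r > 0` the Kretschmann scalar of Kerr is `48 M² / r⁶` (there `cos θ = 0`). [cite: arXiv07060622, §3] -/
theorem kretschmannScalar_equatorial (h : kretschmannScalar_closedForm) (M a : ℝ) {x : E4}
    (hr : 0 < Kerr.radius a x) (hx : x 3 = 0) :
    MetricCoord.rmNormSqAt (Kerr.bilin M a) x = 48 * M ^ 2 / Kerr.radius a x ^ 6 := by
  rw [h M a x hr, hx, zero_div, mul_zero]
  push_cast
  rw [zero_mul, add_zero, ← Complex.ofReal_pow, Complex.ofReal_re]
  have hr6 : (Kerr.radius a x ^ 2 + (0 : ℝ) ^ 2) ^ 6 = Kerr.radius a x ^ 12 := by ring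
  rw [hr6]
  have hr0 : Kerr.radius a x ≠ 0 := hr.ne'
  field_simp

/-- Under the fact the equatorial Kretschmann scalar of Kerr is POSITIVE for `M ≠ 0`. [cite: arXiv07060622, §3] -/
theorem kretschmannScalar_equatorial_pos (h : kretschmannScalar_closedForm) {M : ℝ} (hM : M ≠ 0)
    (a : ℝ) {x : E4} (hr : 0 < Kerr.radius a x) (hx : x 3 = 0) :
    0 < MetricCoord.rmNormSqAt (Kerr.bilin M a) x := by
  rw [kretschmannScalar_equatorial h M a hr hx]
  positivity

end Literature.Geometry.Lorentzian.Kerr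

end
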